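import Literature.Probability.Percolation.QuadSubquadThickeningBand
import Literature.Probability.Percolation.QuadCrossingSubquadTopology
import Literature.Topology.PlaneTopology.OpenSetArcs
import HarnessLib

/-!
# Sub-quad thickening: a crossing arc avoiding a closed set runs inside a crossed sub-quad avoiding it

Topic `Probability/Percolation`; proofs file next to `QuadCrossingSubquadTopology.lean` (sub-quads
sharing sides; `Quad.IsCrossing.of_subquad`: a crossing of a sub-quad `Q'` of `Q` with
`∂₀Q' ⊆ ∂₀Q`, `∂₂Q' ⊆ ∂₂Q` is a crossing of `Q`).  The converse direction needed to compare
Schramm–Smirnov's crossing events `⊞_Q` (O. Schramm, S. Smirnov, *On the scaling limits of planar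
percolation*, Ann. Probab. 39 (2011), §1.3: "a crossing of `Q` is a connected compact subset of
`[Q]` that intersects both opposite sides `∂₀Q` and `∂₂Q`") with their localised forms — crossings
of sub-quads off a given closed set, as in the open clause of the pivotal predicate
`QuadConfig.IsPivotalAt` (`FlipFairKernel.lean`) — is the following thickening statement, proved
here for crossings that are simple ARCS (the case of crossings drawn on lattice edges, which
contain such arcs, `Z2LatticePivotalOpenClauseConverse.lean`):

* `Quad.exists_subquad_isCrossing_subset` — **if a simple arc `K ⊆ [Q]` from a point of `∂₀Q` to a
  point of `∂₂Q` misses the closed set `C`, then some quad `Q'` with `[Q'] ⊆ [Q] ∖ C`,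
  `∂₀Q' ⊆ ∂₀Q`, `∂₂Q' ⊆ ∂₂Q` has a crossing `K' ⊆ K`** (so `Q' ∈ S` for every lower set `S ∋ Q`
  generated by crossings inside `K`, while `[Q']` stays off `C`).

Proof.  Straighten `Q` by a homeomorphism `H` of `ℂ` with `[Q] = H([-1,1]²)` and the sides on the
edges (`Quad.exists_straighten`, Schoenflies); trim the pulled-back arc to a sub-arc `α` from the
left edge to the right edge meeting them only at its end-points (first-hit sub-arcs,
`IsSimpleArc.exists_subarc_of_isClosed`); cut a band quad around `α` inside the square and off
`H⁻¹(C)` (`exists_band_quad`, `QuadSubquadThickeningBand.lean`: the two closed Jordan domains above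
and below `α`, read as quads by Schoenflies, glued along `α` and thinned by uniform continuity);
push forward by `H`.  Everything is proved; no named fact is introduced.  Not here: the same for
merely path-connected crossings (it needs "paths contain arcs", absent from Mathlib and the tree
in that generality).

## References

* O. Schramm, S. Smirnov, Ann. Probab. 39 (2011) 1768–1814, arXiv:1101.5820, §1.3.
  [SchrammSmirnov2011]
* Ch. Pommerenke, *Boundary Behaviour of Conformal Maps* (1992), §2.3 Cor. 2.9 (Schoenflies).
  [PommerenkeBBCM1992]
-/

noncomputable section

open scoped unitInterval
open Set Metric Function
open Literature.Topology.PlaneTopology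

namespace Literature.Probability.Percolation

namespace QuadCrossing

variable {D : Set ℂ}

namespace Quad

/-- **Trimming a crossing arc of the square.**  A simple arc in `[-1,1]²` from a point of the left
edge to a point of the right edge contains a sub-arc from a point `a'` of the left edge to a point
`b'` of the right edge meeting the lines `re = ∓1` only at `a'`, `b'`. [folklore] -/
theorem exists_subarc_trimmed {K : Set ℂ} {p q : ℂ} (hK : IsSimpleArc K p q)
    (hKS : K ⊆ Icc (-1 : ℝ) 1 ×ℂ Icc (-1 : ℝ) 1) (hp : p.re = -1) (hq : q.re = 1) :
    ∃ α a' b', α ⊆ K ∧ IsSimpleArc α a' b' ∧ a'.re = -1 ∧ b'.re = 1 ∧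
      (∀ z ∈ α, z.re = -1 → z = a') ∧ ∀ z ∈ α, z.re = 1 → z = b' := by
  -- first hit of the right edge
  obtain ⟨K₁, b', hK₁K, hK₁, hK₁C, -⟩ := hK.exists_subarc_of_isClosed (C := {z : ℂ | 1 ≤ z.re})
    (isClosed_le continuous_const Complex.continuous_re) (by simp [hp]) (by simp [hq])
  have hb' : b'.re = 1 := by
    have h1 : b' ∈ K₁ ∩ {z : ℂ | 1 ≤ z.re} := by rw [hK₁C]; rfl
    exact le_antisymm (hKS (hK₁K h1.1)).1.2 h1.2
  have hK₁b : ∀ z ∈ K₁, z.re = 1 → z = b' := fun z hz hzr => by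
    have : z ∈ K₁ ∩ {z : ℂ | 1 ≤ z.re} := ⟨hz, hzr.ge⟩
    rw [hK₁C] at this
    exact this
  -- then, backwards, first hit of the left edge
  obtain ⟨K₂, a', hK₂K, hK₂, hK₂C, -⟩ := hK₁.symm.exists_subarc_of_isClosed
    (C := {z : ℂ | z.re ≤ -1}) (isClosed_le Complex.continuous_re continuous_const)
    (by simp [hb']) (by simp [hp])
  have ha' : a'.re = -1 := by
    have h1 : a' ∈ K₂ ∩ {z : ℂ | z.re ≤ -1} := by rw [hK₂C]; rfl
    exact le_antisymm h1.2 (hKS (hK₁K (hK₂K h1.1))).1.1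
  refine ⟨K₂, a', b', hK₂K.trans hK₁K, hK₂.symm, ha', hb', fun z hz hzr => ?_,
    fun z hz hzr => hK₁b z (hK₂K hz) hzr⟩
  have : z ∈ K₂ ∩ {z : ℂ | z.re ≤ -1} := ⟨hz, hzr.le⟩
  rw [hK₂C] at this
  exact this

/-- **Sub-quad thickening of a crossing arc off a closed set.**  Let `Q ∈ 𝒬_D`, `C ⊆ ℂ` closed,
and `K ⊆ [Q]` a simple arc from a point of `∂₀Q` to a point of `∂₂Q` with `K ∩ C = ∅` (so `K` is a
crossing of `Q` off `C`).  Then there is a quad `Q' ∈ 𝒬_D` with `[Q'] ⊆ [Q] ∖ C`, `∂₀Q' ⊆ ∂₀Q`,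
`∂₂Q' ⊆ ∂₂Q`, having a crossing `K' ⊆ K` (in fact `[Q']` is a band around a sub-arc `K'` of `K`
with `∂₀Q'`, `∂₂Q'` through its end-points).  See the module docstring for the proof.
[cite: SchrammSmirnov2011, §1.3 (quads, crossings, sub-quads)] -/
theorem exists_subquad_isCrossing_subset (Q : Quad D) {C K : Set ℂ} {p q : ℂ} (hC : IsClosed C)
    (hK : IsSimpleArc K p q) (hKQ : K ⊆ Q.carrier) (hp : p ∈ Q.side 0) (hq : q ∈ Q.side 2)
    (hKC : Disjoint K C) :
    ∃ Q' : Quad D, Q'.carrier ⊆ Q.carrier \ C ∧ Q'.side 0 ⊆ Q.side 0 ∧ Q'.side 2 ⊆ Q.side 2 ∧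
      ∃ K' ⊆ K, Q'.IsCrossing K' := by
  obtain ⟨H, -, hcar, hs0, -, hs2, -⟩ := Q.exists_straighten
  set S : Set ℂ := Icc (-1 : ℝ) 1 ×ℂ Icc (-1 : ℝ) 1 with hS
  -- pull back by `H`
  set K₀ : Set ℂ := H.symm '' K with hK₀
  have hK₀ : IsSimpleArc K₀ (H.symm p) (H.symm q) := hK.image H.symm.continuous H.symm.injective
  have hK₀S : K₀ ⊆ S := by
    rintro _ ⟨k, hk, rfl⟩
    obtain ⟨w, hw, hwk⟩ := (hcar ▸ hKQ hk : k ∈ H '' S)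
    rw [← hwk, Homeomorph.symm_apply_apply]
    exact hw
  have hp₀ : (H.symm p).re = -1 := by
    obtain ⟨w, hw, hwp⟩ := (hs0 ▸ hp : p ∈ H '' {z | z ∈ S ∧ z.re = -1})
    rw [← hwp, Homeomorph.symm_apply_apply]
    exact hw.2
  have hq₀ : (H.symm q).re = 1 := by
    obtain ⟨w, hw, hwq⟩ := (hs2 ▸ hq : q ∈ H '' {z | z ∈ S ∧ z.re = 1})
    rw [← hwq, Homeomorph.symm_apply_apply]
    exact hw.2
  -- trim, and cut the band off `H⁻¹(C)`
  obtain ⟨α, a', b', hαK₀, hα, ha', hb', hαa, hαb⟩ := exists_subarc_trimmed hK₀ hK₀S hp₀ hq₀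
  have hαU : α ⊆ (H ⁻¹' C)ᶜ := fun z hz hzC => by
    obtain ⟨k, hk, rfl⟩ := hαK₀ hz
    rw [mem_preimage, Homeomorph.apply_symm_apply] at hzC
    exact Set.disjoint_left.1 hKC hk hzC
  obtain ⟨Q'', hQ''car, hQ''0, hQ''2, hαQ'', haQ'', hbQ''⟩ := exists_band_quad hα
    (hαK₀.trans hK₀S) ha' hb' hαa hαb (hC.preimage H.continuous).isOpen_compl hαU
  -- push forward by `H`
  have hrange : range (H ∘ Q'') ⊆ Q.carrier \ C := by
    rintro _ ⟨z, rfl⟩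
    obtain ⟨hzS, hzU⟩ := hQ''car ⟨z, rfl⟩
    exact ⟨hcar ▸ ⟨Q'' z, hzS, rfl⟩, hzU⟩
  let Q' : Quad D :=
    { toFun := H ∘ Q''
      continuous_toFun := H.continuous.comp Q''.continuous_toFun
      injective_toFun := H.injective.comp Q''.injective_toFun
      range_subset := fun z hz => Q.carrier_subset (hrange hz).1 }
  have hcar' : Q'.carrier = H '' Q''.carrier := by
    show range (H ∘ Q'') = H '' range Q''
    exact range_comp _ _
  have hside : ∀ k, Q'.side k = H '' Q''.side k := fun k => by
    match k with
    | 0 => show (H ∘ Q'') '' _ = H '' (Q'' '' _); exact image_comp _ _ _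
    | 1 => show (H ∘ Q'') '' _ = H '' (Q'' '' _); exact image_comp _ _ _
    | 2 => show (H ∘ Q'') '' _ = H '' (Q'' '' _); exact image_comp _ _ _
    | 3 => show (H ∘ Q'') '' _ = H '' (Q'' '' _); exact image_comp _ _ _
  refine ⟨Q', hrange, ?_, ?_, H '' α, ?_, ?_⟩
  · rw [hside, hs0]
    exact image_mono fun z hz => ⟨(hQ''car (Q''.side_subset_carrier 0 hz)).1, hQ''0 hz⟩
  · rw [hside, hs2]
    exact image_mono fun z hz => ⟨(hQ''car (Q''.side_subset_carrier 2 hz)).1, hQ''2 hz⟩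
  · rintro _ ⟨z, hz, rfl⟩
    obtain ⟨k, hk, rfl⟩ := hαK₀ hz
    rw [Homeomorph.apply_symm_apply]
    exact hk
  · refine ⟨hα.isCompact.image H.continuous,
      (hα.isConnected.image _ H.continuous.continuousOn), ?_, ?_, ?_⟩
    · rw [hcar']; exact image_mono hαQ''
    · exact ⟨H a', ⟨a', hα.left_mem, rfl⟩, by rw [hside]; exact ⟨a', haQ'', rfl⟩⟩
    · exact ⟨H b', ⟨b', hα.right_mem, rfl⟩, by rw [hside]; exact ⟨b', hbQ'', rfl⟩⟩

/-- **Sub-quad thickening, for crossings containing a crossing arc.**  If `K ⊆ [Q]` misses the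
closed set `C` and contains a simple arc from a point of `∂₀Q` to a point of `∂₂Q`, then some quad
`Q'` with `[Q'] ⊆ [Q] ∖ C`, `∂₀Q' ⊆ ∂₀Q`, `∂₂Q' ⊆ ∂₂Q` has a crossing inside `K`.
[cite: SchrammSmirnov2011, §1.3 (quads, crossings, sub-quads)] -/
theorem exists_subquad_isCrossing_subset' (Q : Quad D) {C K : Set ℂ} (hC : IsClosed C)
    (hKQ : K ⊆ Q.carrier) (hKC : Disjoint K C)
    (harc : ∃ L p q, L ⊆ K ∧ IsSimpleArc L p q ∧ p ∈ Q.side 0 ∧ q ∈ Q.side 2) :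
    ∃ Q' : Quad D, Q'.carrier ⊆ Q.carrier \ C ∧ Q'.side 0 ⊆ Q.side 0 ∧ Q'.side 2 ⊆ Q.side 2 ∧
      ∃ K' ⊆ K, Q'.IsCrossing K' := by
  obtain ⟨L, p, q, hLK, hL, hp, hq⟩ := harc
  obtain ⟨Q', h1, h2, h3, K', hK'L, hK'⟩ := Q.exists_subquad_isCrossing_subset hC hL
    (hLK.trans hKQ) hp hq (hKC.mono_left hLK)
  exact ⟨Q', h1, h2, h3, K', hK'L.trans hLK, hK'⟩

end Quad

end QuadCrossing

end Literature.Probability.Percolation
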